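import Summits.BirchSwinnertonDyer.Rank1Residual.Partition.MainConjecturesRowC3AllPrimes
import Summits.BirchSwinnertonDyer.Rank1Residual.Partition.AnticyclotomicControlPublishedPlaces
import HarnessLib

/-!
# The irreducible rank-one rows with the anticyclotomic CONTROL link DISCHARGED by the published
# CGLS 2022 Thm. 5.1.1 (off the anomalous line): only the anticyclotomic main conjecture ∘ BDP remains
# typed (cell `b2b-bsdres`, GLUE seat gen 5 — the "20-line restatement" asked by lit-cgls SESSION 5
# §12.10; companion of `AnticyclotomicControlPublished{,Places}.lean` (lit-cgls) and of
# `MainConjecturesAnticyclotomicGood{Class,Three}.lean`, `MainConjecturesRowC3AllPrimes.lean`)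

HONEST FRAMING (cell `b2b-bsdres`, run/shared/lean/b2b/bsd-rank1-residual/, verbatim in every
file): the goal of the cell is to DELETE the COMBINATION-SHAPED residual classes of the
Birch–Swinnerton-Dyer formula for ALL analytic-rank `≤ 1` elliptic curves over `ℚ` — "full BSD
formula for every rank `≤ 1` curve in class `C`" assembled STRICTLY from published theorems — so
that the rank-`≤ 1` remainder becomes exactly the CONSTRUCTION-SHAPED classes, which are TYPED
(missing-input `Prop`s), NOT attempted. This is not "finishing BSD". Research routes; no claim
beyond the stated classes; nothing booked; no label changes. THEOREMS ONLY (no definition, no named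
fact, no `sorry`); every published theorem enters as one of the tree's existing named Literature
facts BY NAME; every unproved / untyped-in-Literature statement enters as an EXPLICIT binder.

## What this file records

Gen 3's class theorems for the covered irreducible rank-one rows (C2, C3-ordinary, C16) take TWO
typed anticyclotomic links on the constructed `X_ac`: (CTL)ᵍ `hLC` and (IMC≥∘BDP)ᵍ `hLA`, both at
`(κ, γ, 𝔭, embAt 𝔭)` (Castella's convention: log at the strict prime). lit-cgls SESSION 5 re-homed
`X_ac` to Literature and vendored **CGLS 2022 Thm. 5.1.1** as the named fact
`CastellaGrossiLeeSkinner2022.thm511_anticyclotomicControl`, with the kernel adapters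
`X11b.controlOnTreeGoodAt_of_thm511[_of_not_dvd]` / `X11b.indexLowerBoundAt_of_heegner_of_thm511_of_embedding`
— in CGLS's convention (module strict at `v̄`, log through an embedding `ι` inducing `v ≠ v̄`) and
under Thm. 5.1.1's hypothesis `E(ℚ_p)[p] = 0`, discharged at `a_p ≢ 1 (mod p)`. Here the class
theorems are RESTATED accordingly: the control binder `hLC` DISAPPEARS (published), the remaining
typed input `hLA` is asked in CGLS's convention — at every anticyclotomic `κ`, generator `γ`,
embedding `ι : K ↪ ℚ_p` and strict prime `v̄ ∋ p`, `v̄ ≠ inducedPlace ι` — and the pair is taken OFF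
THE ANOMALOUS LINE (`hna : ¬ p ∣ a_p − 1`; on it, irreducible `E[p]` would need JSW 2017 Thm. 3.3.1,
not yet a Literature fact on the re-homed object):

* `bsdp_rankOne_of_thm511_of_columnMainConjecture_odd` — the generic odd-prime pair-level theorem
  (gen 3's `bsdp_rankOne_of_onTreeGoodLinks_of_columnMainConjecture_odd` with `hLC ↦ h511`);
* `RowC2.bsdp_of_bcsThm112b_of_thm511` — row C2 (`r ≤ 1`), off the anomalous line, `p ∤ ∏c_ℓ` in
  rank one: BCS 2025 Thm. 1.1.2 (b) (cyclotomic MC of the twist, PUBLISHED) + CGLS Thm. 5.1.1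
  (control, PUBLISHED) + (IMC≥∘BDP)ᵍ typed (`hLA`; in print BCS Thm. 1.2.4) + cited control;
* `RowC3.bsdp_of_thm511_of_columnMainConjectures` — row C3 at every prime of the row, off the
  anomalous line on the ordinary branch (BCS (b) / Yan–Zhu 4.9 + CGLS 5.1.1 + `hLA`), the supersingular
  branch as in `RowC3.bsdp_of_mainConjectures_of_onTreeGoodLinks` (typed Kobayashi MC + BKO A.5).

References: [CastellaGrossiLeeSkinner2022] Thm. 5.1.1, §2, §2.3; [BurungaleCastellaSkinner2025]
Thm. 1.1.2 (b), Thm. 1.2.4, Cor. 1.3.1; [YanZhu2024MainConjNonCM] Thm. 4.9, 4.12; [Castella2018]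
Thm. 3.2; [JetchevSkinnerWan2017] Thm. 1.2.1, Thm. 3.3.1, §7.4.1; [Miller2011LMS] Def. 1.1;
HOME/b2b-bsdres-lit-cgls/CGLS-GV-TYPING.md §12.10; HOME/b2b-bsdres-lit-glue/GLUE.md §G3.4 (A1′).
-/

set_option autoImplicit false

noncomputable section

open scoped Classical

open WeierstrassCurve NumberField IsDedekindDomain Literature.NumberTheory.EllipticCurves
  Literature.NumberTheory.EllipticCurves.ModularForms Literature.NumberTheory.Automorphic
  Literature.NumberTheory.EllipticCurves.Rank1Residual
  Literature.NumberTheory.EllipticCurves.YanZhu2026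
  Literature.NumberTheory.EllipticCurves.BurungaleCastellaSkinner2025
  Literature.NumberTheory.EllipticCurves.BurungaleKobayashiOta2024
  Literature.NumberTheory.EllipticCurves.CastellaGrossiLeeSkinner2022
  Summit.BirchSwinnertonDyer.BirchSwinnertonDyer.Theorems.Rank1ResidualX1Defs

namespace Summit.BirchSwinnertonDyer.Rank1Residual

/-! ### §1. The generic odd-prime theorem with the control link published -/

/-- **Rank one, generic odd prime `p ≥ 3`, off the anomalous line: the column's typed cyclotomic
main conjecture + CGLS 2022 Thm. 5.1.1 (PUBLISHED anticyclotomic control) + the typed anticyclotomic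
main conjecture ∘ BDP ⇒ `BSD(E,p)`.** Gen 3's `bsdp_rankOne_of_onTreeGoodLinks_of_columnMainConjecture_odd`
with its control binder `hLC` REPLACED by the named fact `h511` (through lit-cgls's
`X11b.indexLowerBoundAt_of_heegner_of_thm511_of_embedding`: the hypotheses `rank_ℤ E(K) = 1`,
`#Ш(E/K)[p^∞] < ∞`, `P_K` non-torsion of Thm. 5.1.1 are discharged by GZK + Gross–Zagier + Kolyvagin
at the Heegner datum, `E(ℚ_p)[p] = 0` by `hna`). The remaining typed input `hLA` = (IMC≥∘BDP)ᵍ is asked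
in CGLS's convention: for THIS pair, at every Manin-unit classical Heegner datum over a field with
`d_K` odd `< −4`, every `ℓ ∣ N` and `p` split, `L(E^{d_K},1) ≠ 0`, non-torsion Heegner point, for
every anticyclotomic `κ`, generator `γ`, embedding `ι : K →+* ℚ_p` and strict prime `v̄ ∋ p` with
`v̄ ≠ inducedPlace ι` (PUBLISHED shape on these data: BCS 2025 Thm. 1.2.4 / Yan–Zhu 2026 Thm. 4.12 ∘
Castella 2018 Thm. 3.2). STEP L is evaluated at ONE datum: an anticyclotomic `(κ, γ)` and a prime
`𝔭 ∣ p` exist (`X11b.exists_anticyclotomic_generator_prime`), `ι := embAt 𝔭` (degree one as `p`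
splits), `v̄ :=` the other prime (`X11b.exists_other_prime`).
[cite: CastellaGrossiLeeSkinner2022, Thm. 5.1.1] [cite: BurungaleCastellaSkinner2025, Thm. 1.2.4, Cor. 1.3.1 (r = 1)]
[cite: YanZhu2024MainConjNonCM, Thm. 4.12] [cite: Castella2018, Thm. 3.2 (p. 9)]
[cite: JetchevSkinnerWan2017, §7.4.1 (eq:shalowerK-1)] [cite: Miller2011LMS, Def. 1.1] -/
theorem bsdp_rankOne_of_thm511_of_columnMainConjecture_odd
    -- published inputs (named facts of the tree)
    (hGZ : ∀ (N : ℕ) [NeZero N] (W : WeierstrassCurve ℚ) (K : Type) [Field K] [NumberField K],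
      gross_zagier N W K)
    (hKo : ∀ (N : ℕ) [NeZero N] (W : WeierstrassCurve ℚ) (K : Type) [Field K] [NumberField K],
      kolyvagin N W K)
    (hB : ∀ (N : ℕ) [NeZero N] (W : WeierstrassCurve ℚ) (K : Type) [Field K] [NumberField K],
      Kolyvagin1990_padicValNat_card_sha_le N W K)
    (h511 : thm511_anticyclotomicControl)
    (hGr : greenberg_charValue_rankZero) (hGZK : rank_eq_analyticRank_of_analyticRank_le_one)
    (hmod : hasEntireLFunction_rat) (hpar : nonempty_modularParametrizationData)
    (hnf : exists_isNewformOf) (hHL : HoffsteinLuo1997_exists_twist_L_one_ne_zero)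
    (hMaz : mazur_not_dvd_maninConstant_of_odd) (hNS : integral_neronScaling_of_isGloballyMinimal)
    -- the pair, off the anomalous line
    (W : WeierstrassCurve ℚ) [W.IsElliptic] [W.IsGloballyMinimal] (p : ℕ) [Fact p.Prime]
    (hp3 : 3 ≤ p) (hord : GoodOrd W p) (hna : ¬ (p : ℤ) ∣ W.frobeniusTrace p - 1) (hsurj : Surj W p)
    (hr : W.analyticRank = 1) (htam0 : ¬ p ∣ W.tamagawaProduct)
    -- the column's typed cyclotomic main conjecture at `p`, and the (im)-from-surj witness at `p`
    (hMC : ∀ (V : WeierstrassCurve ℚ) [V.IsElliptic] [V.IsGloballyMinimal],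
      GoodOrd V p → Irr V p → BigIm V p → MazurMainConjecture V p)
    (hIm : ∀ (V : WeierstrassCurve ℚ) [V.IsElliptic] [V.IsGloballyMinimal],
      GoodOrd V p → Surj V p → BigIm V p)
    -- (IMC≥∘BDP)ᵍ at this pair's classical Heegner data, CGLS convention — the ONE typed input
    (hLA : ∀ (N : ℕ) [NeZero N] (K : Type) [Field K] [NumberField K]
      (Dt : ModularParametrizationData W N) (H : HeegnerDatum N (NumberField.discr K)) (ιC : K →+* ℂ)
      (P : (W.baseChange K).toAffine.Point),
      W.conductorNorm ℤ = N → IsImaginaryQuadratic K → Odd (NumberField.discr K) →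
      NumberField.discr K < -4 → SatisfiesHeegnerHypothesis N K → SatisfiesHeegnerHypothesis p K →
      (W.quadraticTwist (NumberField.discr K : ℚ)).entireLFunction 1 ≠ 0 →
      WeierstrassCurve.Affine.Point.map ιC.toRatAlgHom P = heegnerPointComplex Dt H →
      ¬ (p : ℤ) ∣ Dt.c → ¬ IsOfFinAddOrder P →
      ∀ (κ : ZpExtension K p), κ.IsAnticyclotomic →
        ∀ (γ : Field.absoluteGaloisGroup K) [Fact (κ.IsTopGenerator γ)]
          (ι : K →+* ℚ_[p]) (vbar : HeightOneSpectrum (𝓞 K)),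
          ((p : ℕ) : 𝓞 K) ∈ vbar.asIdeal → vbar ≠ X11b.inducedPlace ι →
          X11b.IMCLowerWaldspurgerOnTreeGoodAt p κ vbar γ ι P) :
    BSDp W p := by
  have hp2 : 2 < p := by omega
  refine bsdp_rankOne_of_indexLowerBoundAt_of_columnMainConjecture hGZ hKo hB hGr hGZK hmod hpar hnf hHL
    hMaz hNS W p hp3 hord hsurj hr htam0 hMC hIm ?_
  intro N _ K _ _ Dt H ιC P hN hK hodd hlt hHN hHp hLt hP hc
  -- the Heegner point is non-torsion (Gross–Zagier + modularity at `r_an = 1`)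
  have hPinf : ¬ IsOfFinAddOrder P :=
    X11b.not_isOfFinAddOrder_of_heegner_of_analyticRank_eq_one W N K Dt H ιC P (hGZ N W K) hmod hr hK
      hHN hLt hP
  -- one anticyclotomic datum `(κ, γ)`, a prime `𝔭 ∣ p`, the embedding at `𝔭`, the other prime `v̄`
  obtain ⟨κ, γ, 𝔭, hκ, hγ, h𝔭⟩ := X11b.exists_anticyclotomic_generator_prime (p := p) hK
  haveI : Fact (κ.IsTopGenerator γ) := ⟨hγ⟩
  have hsplit : X11b.SplitsIn K p := hHp p Fact.out (dvd_refl p)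
  obtain ⟨he, hf⟩ := X11b.degreeOne_of_splitsIn hK.1 hsplit h𝔭
  set ι : K →+* ℚ_[p] := X11b.embAt K p 𝔭 h𝔭 he hf with hι
  obtain ⟨vbar, hvbar, hne⟩ :=
    X11b.exists_other_prime hHp (X11b.inducedPlace ι) (X11b.natCast_mem_inducedPlace ι)
  exact X11b.indexLowerBoundAt_of_heegner_of_thm511_of_embedding W p N K Dt H ιC P h511 (hGZ N W K)
    (hKo N W K) hmod hGZK hp2 hord hna hr hN hK hHN hHp hLt hP hκ ι vbar hvbar hne
    (hLA N K Dt H ιC P hN hK hodd hlt hHN hHp hLt hP hc hPinf κ hκ γ ι vbar hvbar hne)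

/-! ### §2. Rows C2 and C3 with the control link published -/

section Rows

variable (W : WeierstrassCurve ℚ) [W.IsElliptic] [W.IsGloballyMinimal] (p : ℕ) [Fact p.Prime]

/-- **Row C2 (`r ≤ 1`) off the anomalous line, with the anticyclotomic control link PUBLISHED.**
`¬cm`, `p > 3` good ordinary, (irr), (im); `a_p ≢ 1 (mod p)` (`hna`); `p ∤ ∏c_ℓ` asked in rank one
(`htam0`). Rank `0`: BCS 2025 Thm. 1.1.2 (b) (`hBCS`) + Greenberg 4.1 (gen 2's
`RowC2.bsdp_rankZero_of_bcsThm112b`). Rank `1`: BCS (b) for the twist + CGLS 2022 Thm. 5.1.1 (`h511`)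
+ the typed (IMC≥∘BDP)ᵍ `hLA` (BCS Thm. 1.2.4 in print) + cited control (§1). Compared with gen 3's
`RowC2.bsdp_of_bcsThm112b_of_onTreeGoodLinks`: one typed binder instead of two.
[cite: BurungaleCastellaSkinner2025, Thm. 1.1.2 (b), Thm. 1.2.4, Cor. 1.3.1]
[cite: CastellaGrossiLeeSkinner2022, Thm. 5.1.1] [cite: Miller2011LMS, Def. 1.1] -/
theorem RowC2.bsdp_of_bcsThm112b_of_thm511
    (hGZ : ∀ (N : ℕ) [NeZero N] (W : WeierstrassCurve ℚ) (K : Type) [Field K] [NumberField K],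
      gross_zagier N W K)
    (hKo : ∀ (N : ℕ) [NeZero N] (W : WeierstrassCurve ℚ) (K : Type) [Field K] [NumberField K],
      kolyvagin N W K)
    (hB : ∀ (N : ℕ) [NeZero N] (W : WeierstrassCurve ℚ) (K : Type) [Field K] [NumberField K],
      Kolyvagin1990_padicValNat_card_sha_le N W K)
    (hBCS : thm112b_charIdeal_eq_padicLFunction_integral) (h511 : thm511_anticyclotomicControl)
    (hGr : greenberg_charValue_rankZero) (hGZK : rank_eq_analyticRank_of_analyticRank_le_one)
    (hmod : hasEntireLFunction_rat) (hpar : nonempty_modularParametrizationData)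
    (hnf : exists_isNewformOf) (hHL : HoffsteinLuo1997_exists_twist_L_one_ne_zero)
    (hMaz : mazur_not_dvd_maninConstant_of_odd) (hNS : integral_neronScaling_of_isGloballyMinimal)
    (h : RowC2 W p) (hr : W.analyticRank ≤ 1) (hna : ¬ (p : ℤ) ∣ W.frobeniusTrace p - 1)
    (htam0 : W.analyticRank = 1 → ¬ p ∣ W.tamagawaProduct)
    (hLA : ∀ (N : ℕ) [NeZero N] (K : Type) [Field K] [NumberField K]
      (Dt : ModularParametrizationData W N) (H : HeegnerDatum N (NumberField.discr K)) (ιC : K →+* ℂ)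
      (P : (W.baseChange K).toAffine.Point),
      W.conductorNorm ℤ = N → IsImaginaryQuadratic K → Odd (NumberField.discr K) →
      NumberField.discr K < -4 → SatisfiesHeegnerHypothesis N K → SatisfiesHeegnerHypothesis p K →
      (W.quadraticTwist (NumberField.discr K : ℚ)).entireLFunction 1 ≠ 0 →
      WeierstrassCurve.Affine.Point.map ιC.toRatAlgHom P = heegnerPointComplex Dt H →
      ¬ (p : ℤ) ∣ Dt.c → ¬ IsOfFinAddOrder P →
      ∀ (κ : ZpExtension K p), κ.IsAnticyclotomic →
        ∀ (γ : Field.absoluteGaloisGroup K) [Fact (κ.IsTopGenerator γ)]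
          (ι : K →+* ℚ_[p]) (vbar : HeightOneSpectrum (𝓞 K)),
          ((p : ℕ) : 𝓞 K) ∈ vbar.asIdeal → vbar ≠ X11b.inducedPlace ι →
          X11b.IMCLowerWaldspurgerOnTreeGoodAt p κ vbar γ ι P) :
    BSDp W p := by
  have hp : 3 < p := h.2.1
  have hp5 : 5 ≤ p := (Fact.out : p.Prime).five_le_of_ne_two_of_ne_three (by omega) (by omega)
  rcases Nat.lt_or_ge W.analyticRank 1 with h0 | h1
  · exact RowC2.bsdp_rankZero_of_bcsThm112b hBCS hGr hpar hGZK h (by omega)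
  · have hr1 : W.analyticRank = 1 := le_antisymm hr h1
    exact bsdp_rankOne_of_thm511_of_columnMainConjecture_odd hGZ hKo hB h511 hGr hGZK hmod hpar hnf hHL
      hMaz hNS W p (by omega) h.2.2.1 hna (surj_of_irr_of_bigIm W p h.2.2.2.1 h.2.2.2.2) hr1 (htam0 hr1)
      (fun V _ _ hordV hirrV himV ↦ hBCS V p hp hordV hirrV himV)
      (fun V _ _ _ hsV ↦ X9.bigIm_of_surj V p hp5 hsV) hLA

/-- **Row C3 at every prime of the row with the anticyclotomic control link PUBLISHED on the ordinary
branch (off the anomalous line).** By cases on `p ∣ a_p`: supersingular — the typed Kobayashi signed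
main conjecture (`hKMC`, OPEN in print) + BKO 2024 Cor. A.5 (`hA5`), as in
`RowC3.bsdp_of_mainConjectures_of_onTreeGoodLinks`; ordinary (`hna : a_p ≢ 1`, `htam0 : p ∤ ∏c_ℓ`
asked there) — the column's PUBLISHED cyclotomic MC (BCS (b) `hBCS` for `p > 3` / Yan–Zhu Thm. 4.9
`hYZ` at `p = 3`, (im) at `3` by Wuthrich L. 20 `hW20`) + CGLS Thm. 5.1.1 (`h511`) + the typed
(IMC≥∘BDP)ᵍ `hLA` (§1); (ram) ⇒ surj from modularity + level lowering (`RowC3.surj`).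
[cite: JetchevSkinnerWan2017, Thm. 1.2.1, §7.4.1] [cite: CastellaGrossiLeeSkinner2022, Thm. 5.1.1]
[cite: BurungaleCastellaSkinner2025, Thm. 1.1.2 (b)] [cite: YanZhu2024MainConjNonCM, Thm. 4.9]
[cite: BurungaleKobayashiOta2023, App. A Cor. A.5] [cite: Miller2011LMS, Def. 1.1] -/
theorem RowC3.bsdp_of_thm511_of_columnMainConjectures
    (hGZ : ∀ (N : ℕ) [NeZero N] (W : WeierstrassCurve ℚ) (K : Type) [Field K] [NumberField K],
      gross_zagier N W K)
    (hKo : ∀ (N : ℕ) [NeZero N] (W : WeierstrassCurve ℚ) (K : Type) [Field K] [NumberField K],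
      kolyvagin N W K)
    (hB : ∀ (N : ℕ) [NeZero N] (W : WeierstrassCurve ℚ) (K : Type) [Field K] [NumberField K],
      Kolyvagin1990_padicValNat_card_sha_le N W K)
    (hBCS : thm112b_charIdeal_eq_padicLFunction_integral)
    (hYZ : thm49_charIdeal_eq_padicLFunction_integral)
    (hW20 : Wuthrich2014.lemma20_surjective_threeAdic_of_semistable)
    (h511 : thm511_anticyclotomicControl) (hA5 : corA5_pPart_of_signedCharIdeal_eq)
    (hGr : greenberg_charValue_rankZero) (hGZK : rank_eq_analyticRank_of_analyticRank_le_one)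
    (hmod : hasEntireLFunction_rat) (hpar : nonempty_modularParametrizationData)
    (hnf : exists_isNewformOf) (hLL : diamond1995_refinedSerre)
    (hHL : HoffsteinLuo1997_exists_twist_L_one_ne_zero)
    (hMaz : mazur_not_dvd_maninConstant_of_odd) (hNS : integral_neronScaling_of_isGloballyMinimal)
    (h : RowC3 W p)
    (hna : GoodOrd W p → ¬ (p : ℤ) ∣ W.frobeniusTrace p - 1)
    (htam0 : GoodOrd W p → ¬ p ∣ W.tamagawaProduct)
    (ε : ℤˣ) (hKMC : (p : ℤ) ∣ W.frobeniusTrace p → Supersingular.KobayashiMainConjecture W p ε)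
    (hLA : ∀ (N : ℕ) [NeZero N] (K : Type) [Field K] [NumberField K]
      (Dt : ModularParametrizationData W N) (H : HeegnerDatum N (NumberField.discr K)) (ιC : K →+* ℂ)
      (P : (W.baseChange K).toAffine.Point),
      W.conductorNorm ℤ = N → IsImaginaryQuadratic K → Odd (NumberField.discr K) →
      NumberField.discr K < -4 → SatisfiesHeegnerHypothesis N K → SatisfiesHeegnerHypothesis p K →
      (W.quadraticTwist (NumberField.discr K : ℚ)).entireLFunction 1 ≠ 0 →
      WeierstrassCurve.Affine.Point.map ιC.toRatAlgHom P = heegnerPointComplex Dt H →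
      ¬ (p : ℤ) ∣ Dt.c → ¬ IsOfFinAddOrder P →
      ∀ (κ : ZpExtension K p), κ.IsAnticyclotomic →
        ∀ (γ : Field.absoluteGaloisGroup K) [Fact (κ.IsTopGenerator γ)]
          (ι : K →+* ℚ_[p]) (vbar : HeightOneSpectrum (𝓞 K)),
          ((p : ℕ) : 𝓞 K) ∈ vbar.asIdeal → vbar ≠ X11b.inducedPlace ι →
          X11b.IMCLowerWaldspurgerOnTreeGoodAt p κ vbar γ ι P) :
    BSDp W p := by
  by_cases hdvd : (p : ℤ) ∣ W.frobeniusTrace p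
  · -- supersingular: typed Kobayashi MC (one sign) + BKO Cor. A.5
    exact RowC3.bsdp_rankOne_ss_of_kobayashiMainConjecture_of_corA5 hA5 hmod hGZK h hdvd ε (hKMC hdvd)
  · -- ordinary, off the anomalous line: published column MC + published control + typed IMC∘BDP
    have hord : GoodOrd W p := ⟨h.2.2.1, hdvd⟩
    have hp : 5 ≤ p ∨ p = 3 ∧ (GoodOrd W p ∨ W.frobeniusTrace 3 = 0) := h.2.2.2.2
    have hp3 : 3 ≤ p := by rcases hp with h5 | ⟨h3, -⟩ <;> omega
    refine bsdp_rankOne_of_thm511_of_columnMainConjecture_odd hGZ hKo hB h511 hGr hGZK hmod hpar hnf hHL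
      hMaz hNS W p hp3 hord (hna hord) (RowC3.surj hnf hLL h) h.1 (htam0 hord) ?_ ?_ hLA
    · intro V _ _ hordV hirrV himV
      by_cases h5 : 5 ≤ p
      · exact hBCS V p (by omega) hordV hirrV himV
      · have h3 : p = 3 := by rcases hp with h | ⟨h, -⟩ <;> omega
        subst h3
        exact hYZ V 3 le_rfl hordV hirrV himV
    · intro V _ _ hordV hsV
      by_cases h5 : 5 ≤ p
      · exact X9.bigIm_of_surj V p h5 hsV
      · have h3 : p = 3 := by rcases hp with h | ⟨h, -⟩ <;> omega
        subst h3
        exact X9.bigIm_three_of_surj V hW20 (Or.inl hordV.1) hsV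

end Rows

end Summit.BirchSwinnertonDyer.Rank1Residual

end
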